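import Literature.NumberTheory.CubicFields.VoronoiRelativeMinima
import HarnessLib

/-!
# The Voronoi chain of relative minima of a fractional ideal (cubic field of signature (1,1))

Topic `Literature/NumberTheory/CubicFields`; continues `VoronoiRelativeMinima.lean`. For a cubic
number field `K` with a real embedding `σ₁` and a non-real embedding `σ₂`, a nonzero fractional
ideal `I` and a unit `ε` of `𝓞 K` with `σ₁ ε > 1` (one exists by Dirichlet: the unit rank is one),
the relative minima of `I` with `σ₁ > 0` form ONE two-sided chain (Voronoi 1896; Delone–Faddeev
1964, Ch. IV; this is the "infrastructure" walked by the Voronoi / Williams–Dueck–Schmid /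
Buchmann–Williams regulator algorithms for complex cubic fields):

* `posRelMinima σ₁ σ₂ I` — the relative minima with `σ₁ > 0` (one of each pair `±θ`);
  `posRelMinima_nonempty`;
* `finite_posRelMinima_band` — local finiteness: finitely many of them have `σ₁` in a band `[a, b]`;
* `voronoiSucc σ₁ σ₂ I μ` / `voronoiPred σ₁ σ₂ I μ` — the successor (least positive minimum with
  larger `σ₁`) and predecessor, with `voronoiSucc_spec`, `voronoiPred_spec`, `voronoiSucc_pred`,
  `voronoiPred_succ`, and equivariance under positive units `voronoiSucc_unit_mul`;
* `exists_iterate_voronoiSucc_eq` — every positive minimum above `μ` is an iterated successor of `μ`;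
* `voronoiChain σ₁ σ₂ I x₀ : ℤ → K` — the two-sided chain through `x₀` (iterated successors for
  `i ≥ 0`, iterated predecessors for `i ≤ 0`), with `voronoiChain_zero`, `voronoiChain_succ`,
  `voronoiChain_mem`, `voronoiChain_strictMono` and completeness `exists_voronoiChain_eq`
  (every positive relative minimum of `I` is on the chain).

Design: `voronoiSucc`/`voronoiPred` are total functions on `K` (by `Classical.epsilon`; junk off
`posRelMinima` or when no successor exists) and `voronoiChain` is defined without proof arguments;
all properties carry the hypotheses `Module.finrank ℚ K = 3`, `∃ z, conj (σ₂ z) ≠ σ₂ z` and a unit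
`ε` with `1 < σ₁ ε` explicitly. Not here: periodicity under units, gap bounds, reduced ideals,
Voronoi's algorithm computing the successor.

## References

* G. Voronoi, *On a generalization of the algorithm of continued fractions* (1896).
* B. N. Delone, D. K. Faddeev, *The theory of irrationalities of the third degree*, Transl. Math.
  Monographs 10, AMS (1964), Ch. IV.
* H. C. Williams, G. W. Dueck, B. K. Schmid, *A rapid method of evaluating the regulator and class
  number of a pure cubic field*, Math. Comp. 41 (1983), §§2–3.
-/

namespace Literature.NumberTheory.CubicFields

open scoped NumberField ComplexConjugate
open NumberField

section Chain

variable {K : Type*} [Field K] [NumberField K] {σ₁ : K →+* ℝ} {σ₂ : K →+* ℂ}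
  {I : FractionalIdeal (nonZeroDivisors (𝓞 K)) K}

/-- The relative minima with positive real conjugate (one of each pair `±θ`). [folklore] -/
def posRelMinima (σ₁ : K →+* ℝ) (σ₂ : K →+* ℂ) (I : FractionalIdeal (nonZeroDivisors (𝓞 K)) K) : Set K :=
  {μ | μ ∈ relMinima σ₁ σ₂ I ∧ 0 < σ₁ μ}

omit [NumberField K] in
/-- Units with positive real conjugate act on `posRelMinima`. [folklore] -/
theorem unit_mul_mem_posRelMinima {μ : K} (hμ : μ ∈ posRelMinima σ₁ σ₂ I) (u : (𝓞 K)ˣ)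
    (hu : 0 < σ₁ (algebraMap (𝓞 K) K u)) : algebraMap (𝓞 K) K u * μ ∈ posRelMinima σ₁ σ₂ I :=
  ⟨unit_mul_mem_relMinima hμ.1 u, by rw [map_mul]; exact mul_pos hu hμ.2⟩

omit [NumberField K] in
/-- The real conjugate of the inverse unit. [folklore] -/
theorem apply_unit_inv (u : (𝓞 K)ˣ) :
    σ₁ (algebraMap (𝓞 K) K ((u⁻¹ : (𝓞 K)ˣ) : 𝓞 K)) = (σ₁ (algebraMap (𝓞 K) K u))⁻¹ := by
  have h : σ₁ (algebraMap (𝓞 K) K ((u⁻¹ : (𝓞 K)ˣ) : 𝓞 K)) * σ₁ (algebraMap (𝓞 K) K u) = 1 := by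
    rw [← map_mul, ← map_mul, Units.inv_mul, map_one, map_one]
  exact eq_inv_of_mul_eq_one_left h

omit [NumberField K] in
/-- The real conjugate of a power of a unit. [folklore] -/
theorem apply_unit_pow (u : (𝓞 K)ˣ) (j : ℕ) :
    σ₁ (algebraMap (𝓞 K) K ((u ^ j : (𝓞 K)ˣ) : 𝓞 K)) = (σ₁ (algebraMap (𝓞 K) K u)) ^ j := by
  rw [Units.val_pow_eq_pow_val, map_pow, map_pow]

variable (hdeg : Module.finrank ℚ K = 3) (hσ₂ : ∃ z : K, starRingEnd ℂ (σ₂ z) ≠ σ₂ z)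
  (ε : (𝓞 K)ˣ) (hε : 1 < σ₁ (algebraMap (𝓞 K) K ε))

include hdeg hσ₂ in
/-- A nonzero fractional ideal has a positive minimum. [folklore] -/
theorem posRelMinima_nonempty (hI : I ≠ 0) : (posRelMinima σ₁ σ₂ I).Nonempty := by
  have hI' : (I : Submodule (𝓞 K) K) ≠ ⊥ := fun h => hI (FractionalIdeal.coeToSubmodule_eq_bot.mp h)
  obtain ⟨x, hx, hx0⟩ := Submodule.exists_mem_ne_zero_of_ne_bot hI'
  obtain ⟨μ, hμ, hpos, -, -⟩ := exists_mem_relMinima_pos_le hdeg hσ₂ (FractionalIdeal.mem_coe.mp hx) hx0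
  exact ⟨μ, hμ, hpos⟩

include hε in
omit [NumberField K] in
/-- There are positive minima with arbitrarily small real conjugate (divide by powers of `ε`). [folklore] -/
theorem exists_posRelMinima_lt {μ : K} (hμ : μ ∈ posRelMinima σ₁ σ₂ I) {b : ℝ} (hb : 0 < b) :
    ∃ ν ∈ posRelMinima σ₁ σ₂ I, σ₁ ν < b := by
  obtain ⟨j, hj⟩ := pow_unbounded_of_one_lt (σ₁ μ / b) hε
  have hε0 : 0 < σ₁ (algebraMap (𝓞 K) K ε) := by linarith
  have hu : 0 < σ₁ (algebraMap (𝓞 K) K (((ε ^ j)⁻¹ : (𝓞 K)ˣ) : 𝓞 K)) := by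
    rw [apply_unit_inv, apply_unit_pow]; positivity
  refine ⟨_, unit_mul_mem_posRelMinima hμ ((ε ^ j)⁻¹) hu, ?_⟩
  rw [map_mul, apply_unit_inv, apply_unit_pow]
  rw [div_lt_iff₀ hb] at hj
  rw [inv_mul_lt_iff₀ (pow_pos hε0 j)]
  linarith

include hε in
omit [NumberField K] in
/-- There are positive minima with arbitrarily large real conjugate (multiply by powers of `ε`). [folklore] -/
theorem exists_posRelMinima_gt {μ : K} (hμ : μ ∈ posRelMinima σ₁ σ₂ I) (b : ℝ) :
    ∃ ν ∈ posRelMinima σ₁ σ₂ I, b < σ₁ ν := by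
  obtain ⟨j, hj⟩ := pow_unbounded_of_one_lt (b / σ₁ μ) hε
  have hε0 : 0 < σ₁ (algebraMap (𝓞 K) K ε) := by linarith
  have hu : 0 < σ₁ (algebraMap (𝓞 K) K ((ε ^ j : (𝓞 K)ˣ) : 𝓞 K)) := by
    rw [apply_unit_pow]; positivity
  refine ⟨_, unit_mul_mem_posRelMinima hμ (ε ^ j) hu, ?_⟩
  rw [map_mul, apply_unit_pow]
  rw [div_lt_iff₀ hμ.2] at hj
  linarith

include hdeg hσ₂ hε in
/-- **Local finiteness**: finitely many positive minima have real conjugate in a band `[a, b]`,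
`a > 0` (they all have `‖σ₂ ·‖` below that of a minimum left of the band). [folklore] -/
theorem finite_posRelMinima_band (hne : (posRelMinima σ₁ σ₂ I).Nonempty) (a b : ℝ) (ha : 0 < a) :
    {ν : K | ν ∈ posRelMinima σ₁ σ₂ I ∧ a ≤ σ₁ ν ∧ σ₁ ν ≤ b}.Finite := by
  obtain ⟨μ, hμ⟩ := hne
  obtain ⟨μ₀, hμ₀, hlt⟩ := exists_posRelMinima_lt ε hε hμ ha
  refine (finite_mem_bounded σ₁ σ₂ hdeg hσ₂ I b ‖σ₂ μ₀‖).subset ?_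
  rintro ν ⟨hν, haν, hνb⟩
  have hne' : μ₀ ≠ ν := fun h => by rw [h] at hlt; linarith
  have h2 : ‖σ₂ ν‖ < ‖σ₂ μ₀‖ :=
    (relMinima_lt_iff hdeg hσ₂ hμ₀.1 hν.1 hμ₀.2 hν.2 hne').mp (by linarith)
  exact ⟨hν.1.1, by rw [abs_of_pos hν.2]; exact hνb, h2.le⟩

include hdeg hσ₂ hε in
/-- **The successor**: a least positive minimum above `μ`. [folklore] -/
theorem exists_voronoiSucc {μ : K} (hμ : μ ∈ posRelMinima σ₁ σ₂ I) :
    ∃ ν ∈ posRelMinima σ₁ σ₂ I, σ₁ μ < σ₁ ν ∧ ∀ l ∈ posRelMinima σ₁ σ₂ I, σ₁ μ < σ₁ l → σ₁ ν ≤ σ₁ l := by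
  have hε0 : 0 < σ₁ (algebraMap (𝓞 K) K ε) := by linarith
  set A : Set K := {ν : K | ν ∈ posRelMinima σ₁ σ₂ I ∧ σ₁ μ ≤ σ₁ ν ∧ σ₁ ν ≤ σ₁ (algebraMap (𝓞 K) K ε * μ)} ∩
    {ν | σ₁ μ < σ₁ ν} with hA
  have hAfin : A.Finite := (finite_posRelMinima_band hdeg hσ₂ ε hε ⟨μ, hμ⟩ _ _ hμ.2).inter_of_left _
  have hεμ : algebraMap (𝓞 K) K ε * μ ∈ A := by
    refine ⟨⟨unit_mul_mem_posRelMinima hμ ε hε0, ?_, le_rfl⟩, ?_⟩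
    · rw [map_mul]; nlinarith [hμ.2]
    · show σ₁ μ < σ₁ (algebraMap (𝓞 K) K ε * μ)
      rw [map_mul]; nlinarith [hμ.2]
  obtain ⟨ν, hνA, hmin⟩ := Set.exists_min_image A (fun l => σ₁ l) hAfin ⟨_, hεμ⟩
  refine ⟨ν, hνA.1.1, hνA.2, fun l hl hlt => ?_⟩
  by_cases hle : σ₁ l ≤ σ₁ (algebraMap (𝓞 K) K ε * μ)
  · exact hmin l ⟨⟨hl, hlt.le, hle⟩, hlt⟩
  · push Not at hle
    exact (hνA.1.2.2.trans hle.le)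

include hdeg hσ₂ hε in
/-- **The predecessor**: a greatest positive minimum below `μ`. [folklore] -/
theorem exists_voronoiPred {μ : K} (hμ : μ ∈ posRelMinima σ₁ σ₂ I) :
    ∃ ν ∈ posRelMinima σ₁ σ₂ I, σ₁ ν < σ₁ μ ∧ ∀ l ∈ posRelMinima σ₁ σ₂ I, σ₁ l < σ₁ μ → σ₁ l ≤ σ₁ ν := by
  have hε0 : 0 < σ₁ (algebraMap (𝓞 K) K ε) := by linarith
  have hu : 0 < σ₁ (algebraMap (𝓞 K) K ((ε⁻¹ : (𝓞 K)ˣ) : 𝓞 K)) := by rw [apply_unit_inv]; positivity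
  have hlow : σ₁ (algebraMap (𝓞 K) K ((ε⁻¹ : (𝓞 K)ˣ) : 𝓞 K) * μ) < σ₁ μ := by
    rw [map_mul, apply_unit_inv, inv_mul_lt_iff₀ hε0]; nlinarith [hμ.2]
  set B : Set K := {ν : K | ν ∈ posRelMinima σ₁ σ₂ I ∧ σ₁ (algebraMap (𝓞 K) K ((ε⁻¹ : (𝓞 K)ˣ) : 𝓞 K) * μ) ≤ σ₁ ν ∧
    σ₁ ν ≤ σ₁ μ} ∩ {ν | σ₁ ν < σ₁ μ} with hB
  have hBfin : B.Finite :=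
    (finite_posRelMinima_band hdeg hσ₂ ε hε ⟨μ, hμ⟩ _ _ (by rw [map_mul]; exact mul_pos hu hμ.2)).inter_of_left _
  have hεμ : algebraMap (𝓞 K) K ((ε⁻¹ : (𝓞 K)ˣ) : 𝓞 K) * μ ∈ B :=
    ⟨⟨unit_mul_mem_posRelMinima hμ _ hu, le_rfl, hlow.le⟩, hlow⟩
  obtain ⟨ν, hνB, hmax⟩ := Set.exists_max_image B (fun l => σ₁ l) hBfin ⟨_, hεμ⟩
  refine ⟨ν, hνB.1.1, hνB.2, fun l hl hlt => ?_⟩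
  by_cases hle : σ₁ (algebraMap (𝓞 K) K ((ε⁻¹ : (𝓞 K)ˣ) : 𝓞 K) * μ) ≤ σ₁ l
  · exact hmax l ⟨⟨hl, hle, hlt.le⟩, hlt⟩
  · push Not at hle
    exact hle.le.trans hνB.1.2.1

/-- The successor function on `K` (the least positive minimum above, when it exists; else junk). [folklore] -/
noncomputable def voronoiSucc (σ₁ : K →+* ℝ) (σ₂ : K →+* ℂ) (I : FractionalIdeal (nonZeroDivisors (𝓞 K)) K)
    (μ : K) : K :=
  Classical.epsilon fun ν => ν ∈ posRelMinima σ₁ σ₂ I ∧ σ₁ μ < σ₁ ν ∧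
    ∀ l ∈ posRelMinima σ₁ σ₂ I, σ₁ μ < σ₁ l → σ₁ ν ≤ σ₁ l

/-- The predecessor function on `K`. [folklore] -/
noncomputable def voronoiPred (σ₁ : K →+* ℝ) (σ₂ : K →+* ℂ) (I : FractionalIdeal (nonZeroDivisors (𝓞 K)) K)
    (μ : K) : K :=
  Classical.epsilon fun ν => ν ∈ posRelMinima σ₁ σ₂ I ∧ σ₁ ν < σ₁ μ ∧
    ∀ l ∈ posRelMinima σ₁ σ₂ I, σ₁ l < σ₁ μ → σ₁ l ≤ σ₁ ν

include hdeg hσ₂ hε in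
/-- Specification of `voronoiSucc`. [folklore] -/
theorem voronoiSucc_spec {μ : K} (hμ : μ ∈ posRelMinima σ₁ σ₂ I) :
    voronoiSucc σ₁ σ₂ I μ ∈ posRelMinima σ₁ σ₂ I ∧ σ₁ μ < σ₁ (voronoiSucc σ₁ σ₂ I μ) ∧
      ∀ l ∈ posRelMinima σ₁ σ₂ I, σ₁ μ < σ₁ l → σ₁ (voronoiSucc σ₁ σ₂ I μ) ≤ σ₁ l := by
  obtain ⟨ν, hν, h1, h2⟩ := exists_voronoiSucc hdeg hσ₂ ε hε hμ
  exact Classical.epsilon_spec (p := fun ν => ν ∈ posRelMinima σ₁ σ₂ I ∧ σ₁ μ < σ₁ ν ∧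
    ∀ l ∈ posRelMinima σ₁ σ₂ I, σ₁ μ < σ₁ l → σ₁ ν ≤ σ₁ l) ⟨ν, hν, h1, h2⟩

include hdeg hσ₂ hε in
/-- Specification of `voronoiPred`. [folklore] -/
theorem voronoiPred_spec {μ : K} (hμ : μ ∈ posRelMinima σ₁ σ₂ I) :
    voronoiPred σ₁ σ₂ I μ ∈ posRelMinima σ₁ σ₂ I ∧ σ₁ (voronoiPred σ₁ σ₂ I μ) < σ₁ μ ∧
      ∀ l ∈ posRelMinima σ₁ σ₂ I, σ₁ l < σ₁ μ → σ₁ l ≤ σ₁ (voronoiPred σ₁ σ₂ I μ) := by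
  obtain ⟨ν, hν, h1, h2⟩ := exists_voronoiPred hdeg hσ₂ ε hε hμ
  exact Classical.epsilon_spec (p := fun ν => ν ∈ posRelMinima σ₁ σ₂ I ∧ σ₁ ν < σ₁ μ ∧
    ∀ l ∈ posRelMinima σ₁ σ₂ I, σ₁ l < σ₁ μ → σ₁ l ≤ σ₁ ν) ⟨ν, hν, h1, h2⟩

include hdeg hσ₂ hε in
/-- `voronoiSucc ∘ voronoiPred = id` on the positive minima. [folklore] -/
theorem voronoiSucc_pred {μ : K} (hμ : μ ∈ posRelMinima σ₁ σ₂ I) : voronoiSucc σ₁ σ₂ I (voronoiPred σ₁ σ₂ I μ) = μ := by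
  obtain ⟨hp, hp1, hp2⟩ := voronoiPred_spec hdeg hσ₂ ε hε hμ
  obtain ⟨hn, hn1, hn2⟩ := voronoiSucc_spec hdeg hσ₂ ε hε hp
  have hle := hn2 μ hμ hp1
  rcases hle.lt_or_eq with hlt | heq
  · exact absurd (hp2 _ hn hlt) (not_le.mpr hn1)
  · exact σ₁.injective heq

include hdeg hσ₂ hε in
/-- `voronoiPred ∘ voronoiSucc = id` on the positive minima. [folklore] -/
theorem voronoiPred_succ {μ : K} (hμ : μ ∈ posRelMinima σ₁ σ₂ I) : voronoiPred σ₁ σ₂ I (voronoiSucc σ₁ σ₂ I μ) = μ := by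
  obtain ⟨hn, hn1, hn2⟩ := voronoiSucc_spec hdeg hσ₂ ε hε hμ
  obtain ⟨hp, hp1, hp2⟩ := voronoiPred_spec hdeg hσ₂ ε hε hn
  have hle := hp2 μ hμ hn1
  rcases hle.lt_or_eq with hlt | heq
  · exact absurd (hn2 _ hp hlt) (not_le.mpr hp1)
  · exact σ₁.injective heq.symm

include hdeg hσ₂ hε in
/-- The successor commutes with positive units. [folklore] -/
theorem voronoiSucc_unit_mul {μ : K} (hμ : μ ∈ posRelMinima σ₁ σ₂ I) (u : (𝓞 K)ˣ) (hu : 0 < σ₁ (algebraMap (𝓞 K) K u)) :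
    voronoiSucc σ₁ σ₂ I (algebraMap (𝓞 K) K u * μ) = algebraMap (𝓞 K) K u * voronoiSucc σ₁ σ₂ I μ := by
  obtain ⟨hn, hn1, hn2⟩ := voronoiSucc_spec hdeg hσ₂ ε hε hμ
  have huμ := unit_mul_mem_posRelMinima hμ u hu
  obtain ⟨hm, hm1, hm2⟩ := voronoiSucc_spec hdeg hσ₂ ε hε huμ
  have huν := unit_mul_mem_posRelMinima hn u hu
  have hup : σ₁ (algebraMap (𝓞 K) K u * μ) < σ₁ (algebraMap (𝓞 K) K u * voronoiSucc σ₁ σ₂ I μ) := by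
    rw [map_mul, map_mul]; exact mul_lt_mul_of_pos_left hn1 hu
  have hle := hm2 _ huν hup
  rcases hle.lt_or_eq with hlt | heq
  · exfalso
    -- `u⁻¹ · voronoiSucc (u μ)` would lie strictly between `μ` and `voronoiSucc μ`
    have hui : 0 < σ₁ (algebraMap (𝓞 K) K ((u⁻¹ : (𝓞 K)ˣ) : 𝓞 K)) := by rw [apply_unit_inv]; positivity
    have hl := unit_mul_mem_posRelMinima hm (u⁻¹) hui
    have h1 : σ₁ μ < σ₁ (algebraMap (𝓞 K) K ((u⁻¹ : (𝓞 K)ˣ) : 𝓞 K) * voronoiSucc σ₁ σ₂ I (algebraMap (𝓞 K) K u * μ)) := by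
      rw [map_mul, apply_unit_inv, lt_inv_mul_iff₀ hu]
      rw [map_mul] at hm1; exact hm1
    have h2 : σ₁ (algebraMap (𝓞 K) K ((u⁻¹ : (𝓞 K)ˣ) : 𝓞 K) * voronoiSucc σ₁ σ₂ I (algebraMap (𝓞 K) K u * μ)) <
        σ₁ (voronoiSucc σ₁ σ₂ I μ) := by
      rw [map_mul, apply_unit_inv, inv_mul_lt_iff₀ hu]
      rw [map_mul] at hlt; exact hlt
    exact absurd (hn2 _ hl h1) (not_le.mpr h2)
  · exact σ₁.injective heq

include hdeg hσ₂ hε in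
/-- **The interval lemma**: a positive minimum above `μ` is reached from `μ` by finitely many
successor steps (induction on the number of minima in between). [folklore] -/
theorem exists_iterate_voronoiSucc_eq {μ ν : K} (hμ : μ ∈ posRelMinima σ₁ σ₂ I) (hν : ν ∈ posRelMinima σ₁ σ₂ I)
    (hle : σ₁ μ ≤ σ₁ ν) : ∃ j : ℕ, (voronoiSucc σ₁ σ₂ I)^[j] μ = ν := by
  -- the number of minima in `(σ₁ μ, σ₁ ν]`
  set S : K → Set K := fun m => {l : K | l ∈ posRelMinima σ₁ σ₂ I ∧ σ₁ m ≤ σ₁ l ∧ σ₁ l ≤ σ₁ ν} ∩ {l | σ₁ m < σ₁ l}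
    with hS
  have hfin : ∀ m ∈ posRelMinima σ₁ σ₂ I, (S m).Finite := fun m hm =>
    (finite_posRelMinima_band hdeg hσ₂ ε hε ⟨m, hm⟩ _ _ hm.2).inter_of_left _
  suffices H : ∀ n : ℕ, ∀ m ∈ posRelMinima σ₁ σ₂ I, σ₁ m ≤ σ₁ ν → (S m).ncard = n →
      ∃ j : ℕ, (voronoiSucc σ₁ σ₂ I)^[j] m = ν from H _ μ hμ hle rfl
  intro n
  induction n using Nat.strong_induction_on with
  | _ n ih =>
    intro m hm hmle hcard
    rcases hmle.lt_or_eq with hlt | heq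
    · obtain ⟨hn, hn1, hn2⟩ := voronoiSucc_spec hdeg hσ₂ ε hε hm
      have hnle : σ₁ (voronoiSucc σ₁ σ₂ I m) ≤ σ₁ ν := hn2 ν hν hlt
      have hsub : S (voronoiSucc σ₁ σ₂ I m) ⊆ S m := by
        rintro l ⟨⟨hl, -, h2⟩, h3⟩
        have h3' : σ₁ (voronoiSucc σ₁ σ₂ I m) < σ₁ l := h3
        exact ⟨⟨hl, (hn1.trans h3').le, h2⟩, hn1.trans h3'⟩
      have hmem : voronoiSucc σ₁ σ₂ I m ∈ S m := ⟨⟨hn, hn1.le, hnle⟩, hn1⟩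
      have hnmem : voronoiSucc σ₁ σ₂ I m ∉ S (voronoiSucc σ₁ σ₂ I m) := fun h => by
        have h2 : σ₁ (voronoiSucc σ₁ σ₂ I m) < σ₁ (voronoiSucc σ₁ σ₂ I m) := h.2
        exact lt_irrefl _ h2
      have hssub : S (voronoiSucc σ₁ σ₂ I m) ⊂ S m := ⟨hsub, fun h => hnmem (h hmem)⟩
      have hlt_card : (S (voronoiSucc σ₁ σ₂ I m)).ncard < n := by
        rw [← hcard]; exact Set.ncard_lt_ncard hssub (hfin m hm)
      obtain ⟨j, hj⟩ := ih _ hlt_card _ hn hnle rfl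
      exact ⟨j + 1, by rw [Function.iterate_succ_apply]; exact hj⟩
    · exact ⟨0, σ₁.injective heq⟩

include hdeg hσ₂ hε in
/-- Iterated successors of a positive minimum are positive minima. [folklore] -/
theorem iterate_voronoiSucc_mem {μ : K} (hμ : μ ∈ posRelMinima σ₁ σ₂ I) (j : ℕ) :
    (voronoiSucc σ₁ σ₂ I)^[j] μ ∈ posRelMinima σ₁ σ₂ I := by
  induction j with
  | zero => exact hμ
  | succ j ih => rw [Function.iterate_succ_apply']; exact (voronoiSucc_spec hdeg hσ₂ ε hε ih).1

include hdeg hσ₂ hε in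
/-- Iterated predecessors of a positive minimum are positive minima. [folklore] -/
theorem iterate_voronoiPred_mem {μ : K} (hμ : μ ∈ posRelMinima σ₁ σ₂ I) (j : ℕ) :
    (voronoiPred σ₁ σ₂ I)^[j] μ ∈ posRelMinima σ₁ σ₂ I := by
  induction j with
  | zero => exact hμ
  | succ j ih => rw [Function.iterate_succ_apply']; exact (voronoiPred_spec hdeg hσ₂ ε hε ih).1

include hdeg hσ₂ hε in
/-- `voronoiPred^[j] ∘ voronoiSucc^[j] = id` on the positive minima. [folklore] -/
theorem iterate_voronoiPred_iterate_voronoiSucc {μ : K} (hμ : μ ∈ posRelMinima σ₁ σ₂ I) (j : ℕ) :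
    (voronoiPred σ₁ σ₂ I)^[j] ((voronoiSucc σ₁ σ₂ I)^[j] μ) = μ := by
  induction j with
  | zero => rfl
  | succ j ih =>
    rw [Function.iterate_succ_apply, Function.iterate_succ_apply',
      voronoiPred_succ hdeg hσ₂ ε hε (iterate_voronoiSucc_mem hdeg hσ₂ ε hε hμ j), ih]

/-- **The Voronoi chain through `x₀`**: `θ i = voronoiSucc^[i] x₀` for `i ≥ 0` and
`θ (-j) = voronoiPred^[j] x₀` for `j ≥ 0` (Delone–Faddeev Ch. IV: the two-sided sequence of
relative minima of `I` with increasing real conjugate). Meaningful for `x₀ ∈ posRelMinima σ₁ σ₂ I`. [folklore] -/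
noncomputable def voronoiChain (σ₁ : K →+* ℝ) (σ₂ : K →+* ℂ)
    (I : FractionalIdeal (nonZeroDivisors (𝓞 K)) K) (x₀ : K) (i : ℤ) : K :=
  if 0 ≤ i then (voronoiSucc σ₁ σ₂ I)^[i.toNat] x₀ else (voronoiPred σ₁ σ₂ I)^[(-i).toNat] x₀

omit [NumberField K] in
/-- The chain at a natural index is an iterated successor. [folklore] -/
theorem voronoiChain_natCast (x₀ : K) (j : ℕ) :
    voronoiChain σ₁ σ₂ I x₀ (j : ℤ) = (voronoiSucc σ₁ σ₂ I)^[j] x₀ := by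
  simp [voronoiChain]

omit [NumberField K] in
/-- The chain at a non-positive index is an iterated predecessor. [folklore] -/
theorem voronoiChain_neg_natCast (x₀ : K) (j : ℕ) :
    voronoiChain σ₁ σ₂ I x₀ (-(j : ℤ)) = (voronoiPred σ₁ σ₂ I)^[j] x₀ := by
  rcases Nat.eq_zero_or_pos j with rfl | hj
  · simp [voronoiChain]
  · rw [voronoiChain, if_neg (by omega), neg_neg, Int.toNat_natCast]

omit [NumberField K] in
/-- The chain starts at `x₀`. [folklore] -/
theorem voronoiChain_zero (x₀ : K) : voronoiChain σ₁ σ₂ I x₀ 0 = x₀ := by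
  simp [voronoiChain]

include hdeg hσ₂ hε in
/-- Every chain element is a positive minimum. [folklore] -/
theorem voronoiChain_mem {x₀ : K} (hx₀ : x₀ ∈ posRelMinima σ₁ σ₂ I) (i : ℤ) :
    voronoiChain σ₁ σ₂ I x₀ i ∈ posRelMinima σ₁ σ₂ I := by
  obtain ⟨j, rfl | rfl⟩ := Int.eq_nat_or_neg i
  · rw [voronoiChain_natCast]; exact iterate_voronoiSucc_mem hdeg hσ₂ ε hε hx₀ j
  · rw [voronoiChain_neg_natCast]; exact iterate_voronoiPred_mem hdeg hσ₂ ε hε hx₀ j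

include hdeg hσ₂ hε in
/-- **The chain steps by the successor**: `θ (i + 1) = voronoiSucc (θ i)`. [folklore] -/
theorem voronoiChain_succ {x₀ : K} (hx₀ : x₀ ∈ posRelMinima σ₁ σ₂ I) (i : ℤ) :
    voronoiChain σ₁ σ₂ I x₀ (i + 1) = voronoiSucc σ₁ σ₂ I (voronoiChain σ₁ σ₂ I x₀ i) := by
  obtain ⟨j, rfl | rfl⟩ := Int.eq_nat_or_neg i
  · rw [voronoiChain_natCast, show (j : ℤ) + 1 = ((j + 1 : ℕ) : ℤ) by push_cast; ring,
      voronoiChain_natCast, Function.iterate_succ_apply']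
  · cases j with
    | zero =>
      rw [show -((0 : ℕ) : ℤ) + 1 = ((1 : ℕ) : ℤ) by simp, show -((0 : ℕ) : ℤ) = ((0 : ℕ) : ℤ) by simp,
        voronoiChain_natCast, voronoiChain_natCast]
      rfl
    | succ j =>
      rw [show -((j + 1 : ℕ) : ℤ) + 1 = -((j : ℕ) : ℤ) by push_cast; ring, voronoiChain_neg_natCast,
        voronoiChain_neg_natCast, Function.iterate_succ_apply',
        voronoiSucc_pred hdeg hσ₂ ε hε (iterate_voronoiPred_mem hdeg hσ₂ ε hε hx₀ j)]

include hdeg hσ₂ hε in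
/-- **The chain is strictly increasing in `σ₁`.** [folklore] -/
theorem voronoiChain_strictMono {x₀ : K} (hx₀ : x₀ ∈ posRelMinima σ₁ σ₂ I) :
    StrictMono fun i => σ₁ (voronoiChain σ₁ σ₂ I x₀ i) :=
  strictMono_int_of_lt_succ fun i => by
    rw [voronoiChain_succ hdeg hσ₂ ε hε hx₀]
    exact (voronoiSucc_spec hdeg hσ₂ ε hε (voronoiChain_mem hdeg hσ₂ ε hε hx₀ i)).2.1

include hdeg hσ₂ hε in
/-- **Completeness of the chain** (Voronoi; Delone–Faddeev Ch. IV): every relative minimum of `I`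
with positive real conjugate is on the chain through any one of them. [folklore] -/
theorem exists_voronoiChain_eq {x₀ : K} (hx₀ : x₀ ∈ posRelMinima σ₁ σ₂ I) {ν : K}
    (hν : ν ∈ posRelMinima σ₁ σ₂ I) : ∃ i : ℤ, voronoiChain σ₁ σ₂ I x₀ i = ν := by
  rcases le_or_gt (σ₁ x₀) (σ₁ ν) with hle | hlt
  · obtain ⟨j, hj⟩ := exists_iterate_voronoiSucc_eq hdeg hσ₂ ε hε hx₀ hν hle
    exact ⟨(j : ℤ), by rw [voronoiChain_natCast, hj]⟩
  · obtain ⟨j, hj⟩ := exists_iterate_voronoiSucc_eq hdeg hσ₂ ε hε hν hx₀ hlt.le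
    refine ⟨-(j : ℤ), ?_⟩
    rw [voronoiChain_neg_natCast, ← hj]
    exact iterate_voronoiPred_iterate_voronoiSucc hdeg hσ₂ ε hε hν j

end Chain

end Literature.NumberTheory.CubicFields
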